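/-
Copyright (c) 2026 the pub-hodgecm-mathlib formalisation cell (harness21).  Prover seat hodgecm-mathlib-K2E3-p17 (g11), HCML Track B «K2-LIT» ∕ h413
(`stmt-HodgeConjecture-24833`), R90-TF section S3, (U3-F) assembly layer B2 «the LOCAL PLANTING DATUM at p» (captain's skeleton
`R90/S3/SKELETON-P8-AuxGlobaliseField.K2E3-p17-g11.md` 941dd0e5, step B2; dealer R90-C12-plan (g2) 01:04:01Z).  2026-09-05.
-/
import Summits.HodgeConjecture.HodgeConjecture.Theorems.R90S3KrasnerTransportToCompletion   -- ★ P2″ (K2E4-p14): `isInducing_algHom_padicAlgCl`, `exists_radius_sq_class`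
import Summits.HodgeConjecture.HodgeConjecture.Theorems.R90S3GeneratorInOpen                -- ★ B1: `exists_mem_adjoin_eq_top_of_isOpen`
import Summits.HodgeConjecture.HodgeConjecture.Theorems.R90S3IrreduciblePrescribedConstant  -- ★ P4′: `irreducible_scaleRoots`
import Mathlib.NumberTheory.Padics.PadicIntegers
import Mathlib.Topology.Algebra.Algebra
import HarnessLib

/-!
# R90-TF · S3 · THEOREMS — `R90S3LocalPlantingDatum` ((U3-F) assembly, layer B2): at a `p`-adic completion `K = L_w` with a prescribed square class `m·K^{×2}`,
# a GENERATOR `y = m s²` of `K ∕ ℚ_p` whose minimal polynomial has `ℤ_p`-coefficients congruent to `X^{d₀}` mod `p`, and `r ∈ {1,2,3}` DISTINCT extra unit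
# roots `cᵢ ∈ ℤ_p^×` with PRESCRIBED PRODUCT — so that the p-adic target `H := h·∏ (X − cᵢ)` is monic, separable, with `ℤ_p`-coefficients and `H(0) = p^a` EXACTLY

R90-TF section S3 (dealer R90-C12-plan (g2)); crux H413 (`stmt-HodgeConjecture-24833`, lane `--supports … --as helper`), route `HCCMUnconditional`.  Step B2 of the
(U3-F) assembly behind `stub_R90_S3_auxGlobaliseField` (census (C0): the planted constant term is PINNED to `p^a`; (C2)∕(C3) are ★ P4′∕P3a∕P3b).  INPUT: `K := L_w`
with a continuous finite `ℚ_p`-structure, `ι : K →ₐ[ℚ_p] Q̄_p`, `m ∈ K^×` (the radicand class of `L_w(√m)`), `r ∈ {1,2,3}` and a unit `t ∈ ℤ_p^×` (the prescribed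
product).  OUTPUT (§4 **`exists_localPlantingDatum`**): `y, s ∈ K` with `y ≠ 0`, `y = m·s²`, `ℚ_p⟮y⟯ = ⊤`; a monic `h₀ ∈ ℤ_p[X]` of degree `d₀ = [K:ℚ_p]` mapping to
`minpoly_{ℚ_p} y`, all of whose lower coefficients have norm `< 1` (so NO UNIT of `ℤ_p` is a root of `h₀`); and `c : Fin r → ℤ_p` injective with unit values and
`∏ cᵢ = t`.  Consumers: B4 (`R90S3PlantingTargets`, K2E3-p21: `H := h₀·∏(X − C cᵢ)` mod `p^N`, `H(0) = h₀(0)·∏(−cᵢ)` pinned by the choice `t := (−1)^r·u⁻¹`,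
`h₀(0) = u·p^a` via Mathlib `PadicInt.unitCoeff_spec`) and B6 (`R90S3PlantedRootsAndPlaces`, K2E4-p14: Krasner near `ι y` and the `cᵢ`; `β = y·s′²` via ★ P2″).
★∕Mathlib-only imports; THEOREMS ONLY (no `def`, no `instance`, no notation, no named fact, no `sorry`); never imports `Cruxes/…/Lines`.

THE MATHEMATICS [folklore; Neukirch II (8.2)–(8.4) style].  (§1) The square class `m·K^{×2}` contains an `ι`-ball around `m` (★ P2″ `exists_radius_sq_class`), an OPEN
set since `ι` induces the topology (★ P2″ §1); it contains a generator `y₀ ≠ 0` (★ B1 `exists_mem_adjoin_eq_top_of_isOpen`).  (§2) For `c ∈ ℚ_p^×`,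
`minpoly (c·y₀) = scaleRoots (minpoly y₀) c` (★ P4′ `irreducible_scaleRoots` + Mathlib `scaleRoots_aeval_eq_zero`, `minpoly.eq_of_irreducible_of_monic`) has coefficients
`hᵢ c^{d₀−i}`; with `c := p^{2j}`, `j ≫ 0`, every lower coefficient has norm `< 1`, the polynomial lifts to a monic `h₀ ∈ ℤ_p[X]`, `y := p^{2j} y₀ = m (p^j s₀)²` is still
a generator, and a unit root `u` of `h₀` is impossible (`‖u^{d₀}‖ = 1 > ‖Σ_{i<d₀} hᵢ uⁱ‖`).  (§3) Units `1 + p^k` (`k ≥ 1`) are pairwise distinct, never negatives of one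
another and `≠ 1`; so among `1+p, 1+p², 1+p³` at most one equals a given `t` and at most one squares to `t`, whence some `κ` has `κ ≠ t`, `κ² ≠ t`: the tuples
`(t)`, `(tκ⁻¹, κ)`, `(tκ⁻¹, κ, 1)` are injective with product `t`.

HONEST LABEL: HC_CM is proved only modulo the 7 printed citations (2 remaining named inputs: hLiu418 = stmt-HodgeConjecture-24832, h413 =
stmt-HodgeConjecture-24833) until rung 0 closes; local algebra for a sub-step of a GENUINE residual ((U3-F)); proves nothing printed; count-neutral.
References: [NeukirchANT1999] Ch. II (8.2)–(8.4); [Serre1979] Ch. II §5; [Gouvea1993PadicNumbers] Cor. 6.8.3.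
-/

set_option autoImplicit false
-- the mandated namespace repeats the single-problem summit's segment (`HodgeConjecture.HodgeConjecture`)
set_option linter.dupNamespace false

noncomputable section

namespace Summit.HodgeConjecture.HodgeConjecture.R90.S3

open Polynomial IntermediateField Topology IsDedekindDomain NumberField

variable (p : ℕ) [Fact p.Prime]

/-! ## §1 A non-zero generator in a prescribed square class -/

section Generator

variable {L : Type} [Field L] [NumberField L] (w : HeightOneSpectrum (𝓞 L))
  [Algebra ℚ_[p] (w.adicCompletion L)] [FiniteDimensional ℚ_[p] (w.adicCompletion L)]

/-- **A non-zero GENERATOR in the square class of `m`.**  For `m ≠ 0` in `K = L_w` (continuous finite `ℚ_p`-structure, `ι : K →ₐ[ℚ_p] Q̄_p`) there are `y, s ∈ K`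
with `y ≠ 0`, `y = m·s²` and `ℚ_p⟮y⟯ = ⊤` (the class-ball of ★ P2″ `exists_radius_sq_class` is open because `ι` induces the topology, and ★ B1 puts a generator
in it). [cite: NeukirchANT1999, Ch. II (8.2)] [cite: Serre1979, Ch. II §5] -/
theorem exists_generator_sq_class (hc : Continuous (algebraMap ℚ_[p] (w.adicCompletion L)))
    (ι : w.adicCompletion L →ₐ[ℚ_[p]] PadicAlgCl p) {m : w.adicCompletion L} (hm : m ≠ 0) :
    ∃ y s : w.adicCompletion L, y ≠ 0 ∧ y = m * s ^ 2 ∧ ℚ_[p]⟮y⟯ = ⊤ := by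
  haveI : ContinuousSMul ℚ_[p] (w.adicCompletion L) := continuousSMul_of_algebraMap ℚ_[p] (w.adicCompletion L) hc
  obtain ⟨r, hr, hsq⟩ := exists_radius_sq_class p w hc ι hm
  have hιc : Continuous ι := (isInducing_algHom_padicAlgCl p hc ι).continuous
  -- the open set: the `ι`-ball around `m`, minus `0`
  set U : Set (w.adicCompletion L) := {β | ‖ι β - ι m‖ < r} ∩ {β | β ≠ 0} with hU
  have hUo : IsOpen U := by
    refine IsOpen.inter ?_ isOpen_ne
    have : {β : w.adicCompletion L | ‖ι β - ι m‖ < r} = (fun β => ι β) ⁻¹' Metric.ball (ι m) r := by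
      ext β; simp [Metric.mem_ball, dist_eq_norm]
    rw [this]
    exact Metric.isOpen_ball.preimage hιc
  have hmU : m ∈ U := ⟨by simp [hr], hm⟩
  obtain ⟨y, hyU, hy⟩ := exists_mem_adjoin_eq_top_of_isOpen p hUo ⟨m, hmU⟩
  obtain ⟨s, hs⟩ := hsq y hyU.1
  exact ⟨y, s, hyU.2, hs, hy⟩

end Generator

/-! ## §2 Scaling a generator into `X^{d₀} + p·(…)` shape: `minpoly (c·y) = scaleRoots (minpoly y) c` -/

section Scaling

variable {K : Type*} [Field K] [Algebra ℚ_[p] K] [FiniteDimensional ℚ_[p] K]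

/-- `minpoly (c · y) = scaleRoots (minpoly y) c` for `c ∈ ℚ_p^×` (the right-hand side is monic irreducible — ★ P4′ `irreducible_scaleRoots` — with root `c·y`, Mathlib
`scaleRoots_aeval_eq_zero`). [folklore] -/
theorem minpoly_algebraMap_mul_eq_scaleRoots (y : K) {c : ℚ_[p]} (hc : c ≠ 0) :
    minpoly ℚ_[p] (algebraMap ℚ_[p] K c * y) = (minpoly ℚ_[p] y).scaleRoots c := by
  have hint : IsIntegral ℚ_[p] y := IsIntegral.of_finite ℚ_[p] y
  symm
  exact minpoly.eq_of_irreducible_of_monic (irreducible_scaleRoots (minpoly.irreducible hint) hc)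
    (scaleRoots_aeval_eq_zero (minpoly.aeval ℚ_[p] y)) ((monic_scaleRoots_iff c).2 (minpoly.monic hint))

omit [FiniteDimensional ℚ_[p] K] in
/-- A scalar multiple of a generator by `c ∈ ℚ_p^×` is a generator. [folklore] -/
theorem adjoin_algebraMap_mul_eq_top {y : K} (hy : ℚ_[p]⟮y⟯ = ⊤) {c : ℚ_[p]} (hc : c ≠ 0) : ℚ_[p]⟮algebraMap ℚ_[p] K c * y⟯ = ⊤ := by
  refine eq_top_iff.2 (hy ▸ adjoin_simple_le_iff.2 ?_)
  have hmem : algebraMap ℚ_[p] K c * y ∈ ℚ_[p]⟮algebraMap ℚ_[p] K c * y⟯ := mem_adjoin_simple_self ℚ_[p] _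
  have hc' : algebraMap ℚ_[p] K c⁻¹ ∈ ℚ_[p]⟮algebraMap ℚ_[p] K c * y⟯ := IntermediateField.algebraMap_mem _ _
  have := mul_mem hc' hmem
  rwa [← mul_assoc, ← map_mul, inv_mul_cancel₀ hc, map_one, one_mul] at this

/-- A generator's minimal polynomial has degree `[K : ℚ_p]` (Mathlib `Field.primitive_element_iff_minpoly_natDegree_eq`). [folklore] -/
theorem natDegree_minpoly_eq_finrank_of_adjoin_eq_top {y : K} (hy : ℚ_[p]⟮y⟯ = ⊤) : (minpoly ℚ_[p] y).natDegree = Module.finrank ℚ_[p] K :=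
  (Field.primitive_element_iff_minpoly_natDegree_eq ℚ_[p] y).1 hy

/-- **Lower coefficients can be made small by scaling.**  For a monic `h ∈ ℚ_p[X]` there is `j` such that every lower coefficient of `scaleRoots h (p^{2j})` has norm
`< 1` (coefficient `i < deg h` is `hᵢ · p^{2j(deg h − i)}`, and `p^{−2j} → 0`). [folklore] -/
theorem exists_scaleRoots_coeff_norm_lt_one (h : ℚ_[p][X]) :
    ∃ j : ℕ, ∀ i, i < h.natDegree → ‖(h.scaleRoots ((p : ℚ_[p]) ^ (2 * j))).coeff i‖ < 1 := by
  classical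
  -- a bound for the coefficients
  obtain ⟨M, hM⟩ : ∃ M : ℝ, ∀ i, ‖h.coeff i‖ ≤ M := by
    refine ⟨∑ i ∈ h.support, ‖h.coeff i‖, fun i => ?_⟩
    by_cases hi : i ∈ h.support
    · exact Finset.single_le_sum (fun j _ => norm_nonneg (h.coeff j)) hi
    · rw [notMem_support_iff.1 hi, norm_zero]
      exact Finset.sum_nonneg fun j _ => norm_nonneg _
  have hp1 : (1 : ℝ) < p := by exact_mod_cast (Fact.out : p.Prime).one_lt
  -- `p^{-2j} · (M + 1) < 1` for large `j`
  obtain ⟨j, hj⟩ : ∃ j : ℕ, M + 1 < (p : ℝ) ^ (2 * j) := by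
    obtain ⟨j, hj⟩ := pow_unbounded_of_one_lt (M + 1) hp1
    exact ⟨j, hj.trans_le (pow_le_pow_right₀ hp1.le (by omega))⟩
  refine ⟨j, fun i hi => ?_⟩
  have hMnn : 0 ≤ M := (norm_nonneg _).trans (hM 0)
  have hppos : (0 : ℝ) < (p : ℝ) ^ (2 * j) := by positivity
  rw [coeff_scaleRoots, norm_mul, norm_pow, norm_pow, Padic.norm_p, inv_pow, inv_pow, ← pow_mul]
  -- `‖h_i‖ · p^{-(2j)(deg − i)} ≤ ‖h_i‖ · p^{-2j} < 1`
  have hdi : 1 ≤ h.natDegree - i := by omega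
  calc ‖h.coeff i‖ * ((p : ℝ) ^ (2 * j * (h.natDegree - i)))⁻¹ ≤ M * ((p : ℝ) ^ (2 * j))⁻¹ := by
        apply mul_le_mul (hM i) _ (by positivity) hMnn
        apply inv_anti₀ hppos
        calc (p : ℝ) ^ (2 * j) = (p : ℝ) ^ (2 * j * 1) := by rw [mul_one]
          _ ≤ (p : ℝ) ^ (2 * j * (h.natDegree - i)) := pow_le_pow_right₀ hp1.le (Nat.mul_le_mul_left _ hdi)
    _ < 1 := by
        rw [mul_inv_lt_iff₀ hppos, one_mul]
        linarith

/-- A polynomial over `ℚ_p` all of whose coefficients have norm `≤ 1` lifts to `ℤ_p[X]`, monic of the same degree if monic. [folklore] -/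
theorem exists_padicInt_lift_of_norm_le_one {h : ℚ_[p][X]} (hm : h.Monic) (hcoeff : ∀ i, ‖h.coeff i‖ ≤ 1) :
    ∃ h₀ : ℤ_[p][X], h₀.map (algebraMap ℤ_[p] ℚ_[p]) = h ∧ h₀.natDegree = h.natDegree ∧ h₀.Monic := by
  have hl : h ∈ Polynomial.lifts (algebraMap ℤ_[p] ℚ_[p]) := by
    refine (lifts_iff_coeff_lifts h).2 fun i => ⟨⟨h.coeff i, hcoeff i⟩, ?_⟩
    rw [PadicInt.algebraMap_apply]
  exact lifts_and_natDegree_eq_and_monic hl hm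

/-- **No unit root.**  If `h₀ ∈ ℤ_p[X]` is monic and all its lower coefficients have norm `< 1`, then no unit of `ℤ_p` is a root of `h₀` (reading `u^{d} = −Σ_{i<d} hᵢ uⁱ`
gives `1 = ‖u^d‖ < 1`). [folklore] -/
theorem not_isRoot_of_isUnit_of_coeff_norm_lt_one {h₀ : ℤ_[p][X]} (hm : h₀.Monic) (hlow : ∀ i, i < h₀.natDegree → ‖h₀.coeff i‖ < 1) {u : ℤ_[p]}
    (hu : IsUnit u) : ¬ h₀.IsRoot u := by
  intro hroot
  have hd : 0 < h₀.natDegree := by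
    by_contra h0
    have h0' : h₀.natDegree = 0 := by omega
    have h1 : h₀ = 1 := eq_one_of_monic_natDegree_zero hm h0'
    rw [h1, IsRoot, eval_one] at hroot
    exact one_ne_zero hroot
  have hu1 : ‖u‖ = 1 := PadicInt.isUnit_iff.1 hu
  -- `eval u h₀ = u^d + Σ_{i<d} hᵢ uⁱ`
  have hsum : h₀.eval u = ∑ i ∈ Finset.range (h₀.natDegree + 1), h₀.coeff i * u ^ i := eval_eq_sum_range u
  rw [IsRoot.def, hsum, Finset.sum_range_succ, hm.coeff_natDegree, one_mul] at hroot
  -- the lower sum has norm `< 1`, the top term has norm `1`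
  have hlow' : ‖∑ i ∈ Finset.range h₀.natDegree, h₀.coeff i * u ^ i‖ < 1 := by
    obtain ⟨i, hi, hle⟩ := IsUltrametricDist.exists_norm_finsetSum_le_of_nonempty (Finset.nonempty_range_iff.2 hd.ne')
      (fun i => h₀.coeff i * u ^ i)
    refine hle.trans_lt ?_
    rw [norm_mul, norm_pow, hu1, one_pow, mul_one]
    exact hlow i (Finset.mem_range.1 hi)
  have htop : ‖u ^ h₀.natDegree‖ = 1 := by rw [norm_pow, hu1, one_pow]
  have heq : u ^ h₀.natDegree = -∑ i ∈ Finset.range h₀.natDegree, h₀.coeff i * u ^ i := by linear_combination hroot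
  rw [heq, norm_neg] at htop
  linarith

/-- **The scaled generator.**  From a generator `y₀ = m s₀² ≠ 0`: `y = p^{2j} y₀ = m (p^j s₀)²`, still a non-zero generator, whose minimal polynomial is the image of
a monic `h₀ ∈ ℤ_p[X]` of degree `[K : ℚ_p]` with all lower coefficients of norm `< 1`. [cite: NeukirchANT1999, Ch. II (8.2)] -/
theorem exists_scaled_generator {y₀ m s₀ : K} (hy₀ : y₀ ≠ 0) (hys : y₀ = m * s₀ ^ 2) (hgen : ℚ_[p]⟮y₀⟯ = ⊤) :
    ∃ (y s : K) (h₀ : ℤ_[p][X]), y ≠ 0 ∧ y = m * s ^ 2 ∧ ℚ_[p]⟮y⟯ = ⊤ ∧ h₀.Monic ∧ h₀.natDegree = Module.finrank ℚ_[p] K ∧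
      h₀.map (algebraMap ℤ_[p] ℚ_[p]) = minpoly ℚ_[p] y ∧ (∀ i, i < h₀.natDegree → ‖h₀.coeff i‖ < 1) := by
  haveI : CharZero K := charZero_of_injective_algebraMap (algebraMap ℚ_[p] K).injective
  have hint : IsIntegral ℚ_[p] y₀ := IsIntegral.of_finite ℚ_[p] y₀
  obtain ⟨j, hj⟩ := exists_scaleRoots_coeff_norm_lt_one p (minpoly ℚ_[p] y₀)
  set c : ℚ_[p] := (p : ℚ_[p]) ^ (2 * j) with hcdef
  have hp0 : (p : ℚ_[p]) ≠ 0 := by exact_mod_cast (Fact.out : p.Prime).ne_zero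
  have hc0 : c ≠ 0 := pow_ne_zero _ hp0
  set y : K := algebraMap ℚ_[p] K c * y₀ with hydef
  have hmin : minpoly ℚ_[p] y = (minpoly ℚ_[p] y₀).scaleRoots c := minpoly_algebraMap_mul_eq_scaleRoots p y₀ hc0
  have hmonic : ((minpoly ℚ_[p] y₀).scaleRoots c).Monic := (monic_scaleRoots_iff c).2 (minpoly.monic hint)
  have hdeg : ((minpoly ℚ_[p] y₀).scaleRoots c).natDegree = (minpoly ℚ_[p] y₀).natDegree := natDegree_scaleRoots _ _
  -- all coefficients have norm `≤ 1`: lower ones `< 1`, the top one is `1`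
  have hle : ∀ i, ‖((minpoly ℚ_[p] y₀).scaleRoots c).coeff i‖ ≤ 1 := by
    intro i
    rcases Nat.lt_trichotomy i (minpoly ℚ_[p] y₀).natDegree with hlt | heq | hgt
    · exact (hj i hlt).le
    · rw [heq, ← hdeg, hmonic.coeff_natDegree, norm_one]
    · rw [coeff_eq_zero_of_natDegree_lt (hdeg ▸ hgt), norm_zero]; exact zero_le_one
  obtain ⟨h₀, hmap, hnat, hm₀⟩ := exists_padicInt_lift_of_norm_le_one p hmonic hle
  refine ⟨y, algebraMap ℚ_[p] K ((p : ℚ_[p]) ^ j) * s₀, h₀, mul_ne_zero ((_root_.map_ne_zero (algebraMap ℚ_[p] K)).2 hc0) hy₀, ?_, adjoin_algebraMap_mul_eq_top p hgen hc0, hm₀, ?_,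
    by rw [hmap, hmin], fun i hi => ?_⟩
  · rw [hydef, hys, hcdef, pow_mul', map_pow]; ring
  · rw [hnat, hdeg, natDegree_minpoly_eq_finrank_of_adjoin_eq_top p hgen]
  · -- `‖h₀ᵢ‖ = ‖(scaleRoots … c)ᵢ‖ < 1`
    have hi' : i < (minpoly ℚ_[p] y₀).natDegree := by rw [← hdeg, ← hnat]; exact hi
    have hcoe : ‖h₀.coeff i‖ = ‖((minpoly ℚ_[p] y₀).scaleRoots c).coeff i‖ := by
      rw [← hmap, coeff_map, PadicInt.algebraMap_apply, PadicInt.padic_norm_e_of_padicInt]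
    rw [hcoe]
    exact hj i hi'

end Scaling

/-! ## §3 Distinct units of `ℤ_p` with prescribed product (`r ∈ {1,2,3}`) -/

section Units

/-- `1 + p^k` is a unit of `ℤ_p` for `k ≥ 1` (`‖p^k‖ < 1`, Mathlib `PadicInt.isUnit_iff`, ultrametric). [folklore] -/
theorem isUnit_one_add_pow (k : ℕ) (hk : 1 ≤ k) : IsUnit (1 + (p : ℤ_[p]) ^ k) := by
  rw [PadicInt.isUnit_iff]
  have hlt : ‖(p : ℤ_[p]) ^ k‖ < 1 := by
    rw [PadicInt.norm_p_pow]
    have hp1 : (1 : ℝ) < p := by exact_mod_cast (Fact.out : p.Prime).one_lt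
    exact zpow_lt_one_of_neg₀ hp1 (by omega)
  rw [IsUltrametricDist.norm_add_eq_max_of_norm_ne_norm (by rw [norm_one]; exact hlt.ne'), norm_one, max_eq_left hlt.le]

/-- `1 + p^i ≠ 1 + p^j` for `i ≠ j`, and `1 + p^i ≠ −(1 + p^j)` (the latter since `2 + p^i + p^j` is a positive integer, non-zero in characteristic `0`). [folklore] -/
theorem one_add_pow_ne (i j : ℕ) : (i ≠ j → (1 + (p : ℤ_[p]) ^ i) ≠ 1 + (p : ℤ_[p]) ^ j) ∧ (1 + (p : ℤ_[p]) ^ i) ≠ -(1 + (p : ℤ_[p]) ^ j) := by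
  have hp1 : 1 < p := (Fact.out : p.Prime).one_lt
  constructor
  · intro hij h
    have h' : ((p ^ i : ℕ) : ℤ_[p]) = ((p ^ j : ℕ) : ℤ_[p]) := by push_cast; exact add_left_cancel h
    exact hij (Nat.pow_right_injective (Fact.out : p.Prime).two_le (Nat.cast_injective h'))
  · intro h
    have h' : ((2 + p ^ i + p ^ j : ℕ) : ℤ_[p]) = 0 := by push_cast; linear_combination h
    have : (2 + p ^ i + p ^ j : ℕ) = 0 := by exact_mod_cast h'
    omega

/-- **A unit `κ` avoiding `t` and `√t`**: for every `t ∈ ℤ_p` one of `1+p, 1+p², 1+p³` is `≠ t` and has square `≠ t` (at most one candidate equals `t`; two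
candidates with square `t` would be equal or opposite). [folklore] -/
theorem exists_unit_ne_sq_ne (t : ℤ_[p]) : ∃ κ : ℤ_[p], IsUnit κ ∧ κ ≠ 1 ∧ κ ≠ t ∧ κ ^ 2 ≠ t := by
  have hne1 : ∀ k, 1 ≤ k → (1 + (p : ℤ_[p]) ^ k) ≠ 1 := fun k hk h => by
    have : ((p ^ k : ℕ) : ℤ_[p]) = 0 := by push_cast; linear_combination h
    have : (p ^ k : ℕ) = 0 := by exact_mod_cast this
    exact pow_ne_zero k (Fact.out : p.Prime).ne_zero this
  -- two distinct candidates cannot both square to `t`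
  have hsq : ∀ i j, i ≠ j → (1 + (p : ℤ_[p]) ^ i) ^ 2 = t → (1 + (p : ℤ_[p]) ^ j) ^ 2 ≠ t := by
    intro i j hij hi hj
    have h0 : ((1 + (p : ℤ_[p]) ^ i) - (1 + (p : ℤ_[p]) ^ j)) * ((1 + (p : ℤ_[p]) ^ i) + (1 + (p : ℤ_[p]) ^ j)) = 0 := by linear_combination hi - hj
    rcases mul_eq_zero.1 h0 with h1 | h1
    · exact (one_add_pow_ne p i j).1 hij (sub_eq_zero.1 h1)
    · exact (one_add_pow_ne p i j).2 (eq_neg_of_add_eq_zero_left h1)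
  by_cases h1 : (1 + (p : ℤ_[p]) ^ 1) ≠ t ∧ (1 + (p : ℤ_[p]) ^ 1) ^ 2 ≠ t
  · exact ⟨_, isUnit_one_add_pow p 1 le_rfl, hne1 1 le_rfl, h1.1, h1.2⟩
  by_cases h2 : (1 + (p : ℤ_[p]) ^ 2) ≠ t ∧ (1 + (p : ℤ_[p]) ^ 2) ^ 2 ≠ t
  · exact ⟨_, isUnit_one_add_pow p 2 (by norm_num), hne1 2 (by norm_num), h2.1, h2.2⟩
  by_cases h3 : (1 + (p : ℤ_[p]) ^ 3) ≠ t ∧ (1 + (p : ℤ_[p]) ^ 3) ^ 2 ≠ t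
  · exact ⟨_, isUnit_one_add_pow p 3 (by norm_num), hne1 3 (by norm_num), h3.1, h3.2⟩
  exfalso
  rw [not_and_or, not_not, not_not] at h1 h2 h3
  -- three bad candidates: two share a type
  rcases h1 with h1 | h1 <;> rcases h2 with h2 | h2 <;> rcases h3 with h3 | h3
  · exact (one_add_pow_ne p 1 2).1 (by norm_num) (h1.trans h2.symm)
  · exact (one_add_pow_ne p 1 2).1 (by norm_num) (h1.trans h2.symm)
  · exact (one_add_pow_ne p 1 3).1 (by norm_num) (h1.trans h3.symm)
  · exact hsq 2 3 (by norm_num) h2 h3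
  · exact (one_add_pow_ne p 2 3).1 (by norm_num) (h2.trans h3.symm)
  · exact hsq 1 3 (by norm_num) h1 h3
  · exact hsq 1 2 (by norm_num) h1 h2
  · exact hsq 1 2 (by norm_num) h1 h2

/-- **`r ∈ {1,2,3}` distinct units with prescribed product `t`.**  `(t)`, `(t κ⁻¹, κ)`, `(t κ⁻¹, κ, 1)` with `κ` from `exists_unit_ne_sq_ne`. [folklore] -/
theorem exists_units_injective_prod_eq (t : ℤ_[p]ˣ) (r : ℕ) (hr1 : 1 ≤ r) (hr3 : r ≤ 3) :
    ∃ c : Fin r → ℤ_[p], (∀ i, IsUnit (c i)) ∧ Function.Injective c ∧ ∏ i, c i = (t : ℤ_[p]) := by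
  obtain ⟨κ, hκu, hκ1, hκt, hκsq⟩ := exists_unit_ne_sq_ne p (t : ℤ_[p])
  obtain ⟨κu, rfl⟩ := hκu
  have hk : (κu : ℤ_[p]) * ↑κu⁻¹ = 1 := Units.mul_inv κu
  -- the three shapes
  have hne12 : (t : ℤ_[p]) * ↑κu⁻¹ ≠ κu := by
    intro h; apply hκsq
    calc (κu : ℤ_[p]) ^ 2 = ((t : ℤ_[p]) * ↑κu⁻¹) * κu := by rw [h, sq]
      _ = t := by rw [mul_assoc, Units.inv_mul, mul_one]
  have hne13 : (t : ℤ_[p]) * ↑κu⁻¹ ≠ 1 := by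
    intro h; apply hκt
    calc (κu : ℤ_[p]) = ((t : ℤ_[p]) * ↑κu⁻¹) * κu := by rw [h, one_mul]
      _ = t := by rw [mul_assoc, Units.inv_mul, mul_one]
  rcases Nat.lt_trichotomy r 2 with hr | rfl | hr
  · obtain rfl : r = 1 := by omega
    refine ⟨fun _ => t, fun _ => t.isUnit, fun i j _ => Subsingleton.elim i j, by simp⟩
  · refine ⟨![(t : ℤ_[p]) * ↑κu⁻¹, κu], ?_, ?_, ?_⟩
    · intro i; fin_cases i
      · exact t.isUnit.mul κu⁻¹.isUnit
      · exact κu.isUnit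
    · intro i j hij
      fin_cases i <;> fin_cases j
      · rfl
      · exact absurd hij hne12
      · exact absurd hij.symm hne12
      · rfl
    · simp [Fin.prod_univ_two, mul_assoc, Units.inv_mul]
  · obtain rfl : r = 3 := by omega
    refine ⟨![(t : ℤ_[p]) * ↑κu⁻¹, κu, 1], ?_, ?_, ?_⟩
    · intro i; fin_cases i
      · exact t.isUnit.mul κu⁻¹.isUnit
      · exact κu.isUnit
      · exact isUnit_one
    · intro i j hij
      fin_cases i <;> fin_cases j
      · rfl
      · exact absurd hij hne12
      · exact absurd hij hne13
      · exact absurd hij.symm hne12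
      · rfl
      · exact absurd hij hκ1
      · exact absurd hij.symm hne13
      · exact absurd hij.symm hκ1
      · rfl
    · simp [Fin.prod_univ_three, mul_assoc, Units.inv_mul]

end Units

/-! ## §4 The local planting datum -/

section Datum

variable {L : Type} [Field L] [NumberField L] (w : HeightOneSpectrum (𝓞 L))
  [Algebra ℚ_[p] (w.adicCompletion L)] [FiniteDimensional ℚ_[p] (w.adicCompletion L)]

/-- **THE LOCAL PLANTING DATUM (B2).**  At `K = L_w` with a continuous finite `ℚ_p`-structure and `ι : K →ₐ[ℚ_p] Q̄_p`, for `m ≠ 0`, `r ∈ {1,2,3}` and a unit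
`t ∈ ℤ_p^×`: a non-zero GENERATOR `y = m s²` of `K ∕ ℚ_p`, a monic `h₀ ∈ ℤ_p[X]` of degree `[K : ℚ_p]` mapping to `minpoly_{ℚ_p} y` with all lower coefficients of
norm `< 1` — so that no unit of `ℤ_p` is a root of `h₀` — and an injective `c : Fin r → ℤ_p` of units with `∏ cᵢ = t`.  (B4 forms `H := h₀·∏(X − C cᵢ)`: monic,
separable, `ℤ_p`-coefficients, `H(0) = h₀(0)·∏(−cᵢ)`; with `h₀(0) = u·p^a` (Mathlib `PadicInt.unitCoeff_spec`) and `t := (−1)^r u⁻¹` the constant term is `p^a`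
EXACTLY — census (C0).) [cite: NeukirchANT1999, Ch. II (8.2)-(8.4)] [cite: Gouvea1993PadicNumbers, Cor. 6.8.3] -/
theorem exists_localPlantingDatum (hc : Continuous (algebraMap ℚ_[p] (w.adicCompletion L))) (ι : w.adicCompletion L →ₐ[ℚ_[p]] PadicAlgCl p)
    {m : w.adicCompletion L} (hm : m ≠ 0) (r : ℕ) (hr1 : 1 ≤ r) (hr3 : r ≤ 3) (t : ℤ_[p]ˣ) :
    ∃ (y s : w.adicCompletion L) (h₀ : ℤ_[p][X]) (c : Fin r → ℤ_[p]),
      y ≠ 0 ∧ y = m * s ^ 2 ∧ ℚ_[p]⟮y⟯ = ⊤ ∧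
      h₀.Monic ∧ h₀.natDegree = Module.finrank ℚ_[p] (w.adicCompletion L) ∧ h₀.map (algebraMap ℤ_[p] ℚ_[p]) = minpoly ℚ_[p] y ∧
      (∀ i, i < h₀.natDegree → ‖h₀.coeff i‖ < 1) ∧ (∀ u : ℤ_[p], IsUnit u → ¬ h₀.IsRoot u) ∧
      (∀ i, IsUnit (c i)) ∧ Function.Injective c ∧ ∏ i, c i = (t : ℤ_[p]) := by
  obtain ⟨y₀, s₀, hy₀, hys, hgen⟩ := exists_generator_sq_class p w hc ι hm
  obtain ⟨y, s, h₀, hy, hys', hgen', hm₀, hdeg, hmap, hlow⟩ := exists_scaled_generator p hy₀ hys hgen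
  obtain ⟨c, hcu, hci, hcp⟩ := exists_units_injective_prod_eq p t r hr1 hr3
  exact ⟨y, s, h₀, c, hy, hys', hgen', hm₀, hdeg, hmap, hlow, fun u hu => not_isRoot_of_isUnit_of_coeff_norm_lt_one p hm₀ hlow hu, hcu, hci, hcp⟩

end Datum

end Summit.HodgeConjecture.HodgeConjecture.R90.S3

end
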